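import Summits.CriticalPhenomena.PercolationContinuityZ3.Theorems.Transplant.FKConnectivityAllQForestTreeLevel
import Summits.CriticalPhenomena.PercolationContinuityZ3.Theorems.Transplant.FKConnectivityAllQForestHubPairDecomposition
import HarnessLib

/-!
# The square-free adjacent forest Rayleigh node at the LAMAN LEVEL from ONE hub-pair inequality

Support file (`--supports stmt-CriticalPhenomena-4575`), FK sub-lane `prim-bschramm-fk-1` (generation 30) of the post-continuity
programme; builds on p205010 (kernel theorem, internal audit signed; external expert review pending).  No definitions, no named
facts, no sorries; standard axioms.

With the TREE LEVEL in the kernel (`adjForestNoSq_fibre_of_tight`: the node (♣)⁰ = `AdjForestRayleighNoSqOn` on every TIGHT fibre,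
`2|S| ≤ |M| + 2|u₀| + 2`), the next rung is the LAMAN LEVEL `2|S| = |N| + 2|u₀| + 3`.  g25's hub-pair decomposition
(`adjForestNoSq_bad_split` / `adjForestNoSq_good_split`: `bad(N, u₀) = 2·bad(N ∖ h, u₀ + h) + s-terms`, same for `good`, for a free
pair `h = oa` at the hub) has the feature that at the Laman level the PINNED fibre `(N ∖ h, u₀ + h)` is TIGHT, so its part of the
decomposition is settled by the tree level.  Hence (this file, **`adjForestNoSq_fibre_of_laman_of_hubPair`**): *at the Laman level the
node's inequality on `(N, u₀)` follows from ONE instance of g25's one-class hub-pair inequality (★) — the one for the deleted fibre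
`(N ∖ {oa}, u₀)` and the pair `(o, a)`, for ANY free star pair `oa ∈ N` other than `e, f`.*  Companion of g29/g30's
`adjForestNoSq_fibre_of_laman_of_tsd` (TSD at a NON-neighbour `s`); memo bschramm/FROM-fk-1-g30-LAMAN-IDENTITIES.md §1 shows both are
instances of one statement `J_{os} ≥ 0` (sum of `−χ_eχ_f` over the colourings whose 2-forest class joins `o` and `s`).  Corollary
**`adjForestNoSq_fibre_of_laman_of_hubPairOneClass`**: `HubPairOneClassOn V` ⇒ the node on every Laman-level fibre whose hub meets a
free pair other than `e, f`.
[cite: CibulkaHladkyLaCroixWagner2008, Thm. 1 (p. 2)] [cite: SempleWelsh2008, Conj. 1.1 (p. 2); Thm. 4.2 (p. 11)] [cite: Linusson2011, Prop. 2.6]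
-/

noncomputable section

namespace Summit.CriticalPhenomena.PercolationContinuityZ3.Theorems
namespace FK

open MeasureTheory Set Literature.Probability.LatticeModels Literature.Probability.Percolation
open scoped Classical symmDiff

variable {V : Type*} [Fintype V]

/-- **The node at the Laman level from ONE hub-pair inequality.**  Let `(N, u₀)` (`Disjoint u₀ N`) lie inside `S` with
`2|S| ≤ |N| + 2|u₀| + 3`, and let `h = oa ∈ N` be a free star pair with `a ∉ {o, v, y}`... precisely `o ≠ a`, `h ≠ ov`, `h ≠ oy`.
If the one-class hub-pair inequality (★) holds for the deleted fibre `(N ∖ {h}, u₀)` and the pair `(o, a)`, then `bad ≤ good` on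
`(N, u₀)`: the pinned fibre `(N ∖ {h}, u₀ ∪ {h})` is tight, so the tree level bounds its contribution.
[cite: CibulkaHladkyLaCroixWagner2008, Thm. 1 (p. 2)] [cite: SempleWelsh2008, Conj. 1.1 (p. 2)] [cite: Linusson2011, Prop. 2.6] -/
theorem adjForestNoSq_fibre_of_laman_of_hubPair {N u₀ : BondConfig V} {o v y a : V} (S : Finset V)
    (hd : Disjoint u₀ N) (hvy : v ≠ y) (hoa : o ≠ a) (hav : s(o, a) ≠ s(o, v)) (hay : s(o, a) ≠ s(o, y))
    (hS : ∀ g ∈ N ∪ u₀, ∀ w ∈ g, w ∈ S) (hl : 2 * S.card ≤ N.ncard + 2 * u₀.ncard + 3) (hh : s(o, a) ∈ N)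
    (hstar : fibreCount (N \ {s(o, a)}) u₀ (forestEv V ∩ {ω | s(o, v) ∈ ω ∧ s(o, y) ∈ ω} ∩ reachEv o a)
          (forestEv V ∩ (reachEv o a)ᶜ) +
        fibreCount (N \ {s(o, a)}) u₀ (forestEv V ∩ reachEv o a)
          (forestEv V ∩ {ω | s(o, v) ∈ ω ∧ s(o, y) ∈ ω} ∩ (reachEv o a)ᶜ) ≤
      fibreCount (N \ {s(o, a)}) u₀ (forestEv V ∩ {ω | s(o, v) ∈ ω} ∩ reachEv o a)
          (forestEv V ∩ {ω | s(o, y) ∈ ω} ∩ (reachEv o a)ᶜ) +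
        fibreCount (N \ {s(o, a)}) u₀ (forestEv V ∩ {ω | s(o, y) ∈ ω} ∩ reachEv o a)
          (forestEv V ∩ {ω | s(o, v) ∈ ω} ∩ (reachEv o a)ᶜ)) :
    fibreCount N u₀ (forestEv V ∩ {ω | s(o, v) ∈ ω ∧ s(o, y) ∈ ω}) (forestEv V) ≤
      fibreCount N u₀ (forestEv V ∩ {ω | s(o, v) ∈ ω}) (forestEv V ∩ {ω | s(o, y) ∈ ω}) := by
  set N' : BondConfig V := N \ {s(o, a)} with hN'def
  have hN' : s(o, a) ∉ N' := fun hx => hx.2 rfl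
  have hu : s(o, a) ∉ u₀ := fun hx => (Set.disjoint_left.1 hd hx) hh
  have hNeq : N = insert s(o, a) N' := by
    rw [hN'def, ← union_singleton, sdiff_union_of_subset (singleton_subset_iff.2 hh)]
  -- g25's one-edge decompositions of `bad` and `good`
  have hbad := adjForestNoSq_bad_split (u := u₀) (e := s(o, v)) (f := s(o, y)) hoa hN' hu hav hay
  have hgood := adjForestNoSq_good_split (u := u₀) (e := s(o, v)) (f := s(o, y)) hoa hN' hu hav hay
  rw [← hNeq] at hbad hgood
  -- the pinned fibre `(N', u₀ ∪ {h})` is tight: tree level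
  have hd' : Disjoint (insert s(o, a) u₀) N' := by
    refine Set.disjoint_insert_left.2 ⟨hN', ?_⟩
    exact Set.disjoint_of_subset_right sdiff_subset hd
  have hS' : ∀ g ∈ N' ∪ insert s(o, a) u₀, ∀ w ∈ g, w ∈ S := by
    intro g hg w hw
    rcases hg with hg | hg
    · exact hS g (Or.inl (sdiff_subset hg)) w hw
    · rcases mem_insert_iff.1 hg with rfl | hg
      · exact hS _ (Or.inl hh) w hw
      · exact hS g (Or.inr hg) w hw
  have hcardN : N'.ncard + 1 = N.ncard := by
    rw [hNeq, ncard_insert_of_notMem hN' (toFinite _)]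
  have hcardu : (insert s(o, a) u₀).ncard = u₀.ncard + 1 := ncard_insert_of_notMem hu (toFinite _)
  have htree := adjForestNoSq_fibre_of_tight (o := o) S hd' hvy hS' (by rw [hcardu]; omega)
  rw [hbad, hgood]
  omega

/-- **`HubPairOneClassOn V` ⇒ the node at the Laman level** on every fibre whose hub meets a free pair `oa ∈ N` other than `e, f`
(no non-neighbour needed, cf. `adjForestNoSq_fibre_of_laman_of_tsd`). [cite: SempleWelsh2008, Conj. 1.1 (p. 2)] [cite: Linusson2011, Prop. 2.6] -/
theorem adjForestNoSq_fibre_of_laman_of_hubPairOneClass (hHP : HubPairOneClassOn V) {N u₀ : BondConfig V} {o v y a : V}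
    (S : Finset V) (hd : Disjoint u₀ N) (hvy : v ≠ y) (hoa : o ≠ a) (hav : s(o, a) ≠ s(o, v)) (hay : s(o, a) ≠ s(o, y))
    (hS : ∀ g ∈ N ∪ u₀, ∀ w ∈ g, w ∈ S) (hl : 2 * S.card ≤ N.ncard + 2 * u₀.ncard + 3) (hh : s(o, a) ∈ N) :
    fibreCount N u₀ (forestEv V ∩ {ω | s(o, v) ∈ ω ∧ s(o, y) ∈ ω}) (forestEv V) ≤
      fibreCount N u₀ (forestEv V ∩ {ω | s(o, v) ∈ ω}) (forestEv V ∩ {ω | s(o, y) ∈ ω}) :=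
  adjForestNoSq_fibre_of_laman_of_hubPair S hd hvy hoa hav hay hS hl hh
    (hHP (N \ {s(o, a)}) u₀ (Set.disjoint_of_subset_right sdiff_subset hd) o v y a hvy)

end FK
end Summit.CriticalPhenomena.PercolationContinuityZ3.Theorems

end
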